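import Mathlib
import HarnessLib
import Literature.Analysis.FunctionSpaces.MinkowskiIntegral
import Literature.Analysis.UnboundedOperators.HeatKernel

/-!
# Route `QuarterLogPincer`, crux `TypeIQuantSubcubicExp` (stmt-NavierStokesRegularity-24077), line `quiet_collar` — towards QP2
# (log-weighted typing `StubCutPairLog`), module M1b-Young: MINKOWSKI IN TIME + YOUNG IN SPACE FOR DUHAMEL-TYPE MAJORANTS

The `L³` bound of the Oseen commutator (`…QuietCollarOseenCommutatorL3`) rests on two generic `ℝ≥0∞` inequalities proved here:

* `lintegral_rpow_lintegral_kernel_le` — Young `L¹ × L^p → L^p` for nonnegative kernels in the form `∫⁻ K(x−y)f(y)dy`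
  (the Jensen step `Literature.Analysis.UnboundedOperators.lintegral_mul_rpow_le_of_one_le`, Tonelli, translation invariance);
* `rpow_lintegral_duhamelMajorant_le` — for a measurable kernel `κ ≥ 0` on `ℝ × ℝ³` with slice mass `∫⁻κ(σ,·) ≤ m_κ(σ)` and a
  field `Φ ≥ 0` a.e.-measurable on `(0,t) × ℝ³`:
  `(∫⁻_x (∫⁻_{(0,t)×ℝ³} κ(t−τ,x−y)Φ(τ,y))³)^{1/3} ≤ ∫⁻_{(0,t)} m_κ(t−τ)·‖Φ(τ)‖_{L³} dτ`
  (Tonelli, the tree's Minkowski integral inequality `Literature.Analysis.FunctionSpaces.rpow_inv_lintegral_rpow_lintegral_le'` in `τ`,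
  Young in `y`).

HONEST FRAME: measure-theoretic plumbing; nothing here bears on 24077, W7 or Navier–Stokes regularity (OPEN).  pub-ns-dss typer (g37),
`--supports 24077`.
-/

noncomputable section

set_option linter.dupNamespace false

namespace Summit.NavierStokesRegularity.NavierStokesRegularity.Cruxes.TypeIQuantSubcubicExp.QuietCollar

open MeasureTheory Set Function Filter Real Metric
open scoped ENNReal NNReal Topology
open Literature.Analysis Literature.Analysis.UnboundedOperators Literature.Analysis.FunctionSpaces

/-! ### Young's inequality for `ℝ≥0∞` kernels -/

/-- **YOUNG `L¹ × L^p → L^p` FOR NONNEGATIVE KERNELS**: `∫⁻_x (∫⁻_y K(x−y)f(y))^p ≤ (∫⁻K)^p·∫⁻f^p` for `1 ≤ p`, `K` measurable,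
`f` a.e.-measurable (Jensen against the probability `K(x−·)/∫K`, Tonelli, translation invariance). [folklore] -/
theorem lintegral_rpow_lintegral_kernel_le {K f : EuclideanSpace ℝ (Fin 3) → ℝ≥0∞} (hK : Measurable K)
    (hf : AEMeasurable f volume) {p : ℝ} (hp : 1 ≤ p) :
    ∫⁻ x, (∫⁻ y, K (x - y) * f y) ^ p ≤ (∫⁻ z, K z) ^ p * ∫⁻ y, f y ^ p := by
  set A : ℝ≥0∞ := ∫⁻ z, K z with hA
  have hKx : ∀ x, Measurable fun y => K (x - y) := fun x => hK.comp (measurable_const.sub measurable_id)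
  have hKA : ∀ x, ∫⁻ y, K (x - y) = A := fun x => lintegral_sub_left_eq_self K x
  have hG : AEMeasurable (fun z : EuclideanSpace ℝ (Fin 3) × EuclideanSpace ℝ (Fin 3) => K (z.1 - z.2) * f z.2 ^ p)
      ((volume : Measure (EuclideanSpace ℝ (Fin 3))).prod volume) :=
    ((hK.comp (measurable_fst.sub measurable_snd)).aemeasurable).mul ((hf.comp_snd).pow_const _)
  calc ∫⁻ x, (∫⁻ y, K (x - y) * f y) ^ p ≤ ∫⁻ x, (∫⁻ y, K (x - y)) ^ (p - 1) * ∫⁻ y, K (x - y) * f y ^ p :=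
        lintegral_mono fun x => lintegral_mul_rpow_le_of_one_le (hKx x).aemeasurable hf hp
    _ = ∫⁻ x, A ^ (p - 1) * ∫⁻ y, K (x - y) * f y ^ p := by simp only [hKA]
    _ = A ^ (p - 1) * ∫⁻ y, ∫⁻ x, K (x - y) * f y ^ p := by
        rw [lintegral_const_mul'' _ hG.lintegral_prod_right', lintegral_lintegral_swap hG]
    _ = A ^ (p - 1) * ∫⁻ y, (∫⁻ x, K (x - y)) * f y ^ p := by
        congr 1
        refine lintegral_congr fun y => ?_
        have hKy : Measurable (fun x : EuclideanSpace ℝ (Fin 3) => K (x - y)) := hK.comp (measurable_id.sub measurable_const)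
        rw [lintegral_mul_const _ hKy]
    _ = A ^ (p - 1) * ∫⁻ y, A * f y ^ p := by
        congr 1
        refine lintegral_congr fun y => ?_
        rw [lintegral_sub_right_eq_self K y]
    _ = A ^ p * ∫⁻ y, f y ^ p := by
        rw [lintegral_const_mul'' _ (hf.pow_const _), ← mul_assoc]
        congr 1
        conv_rhs => rw [← sub_add_cancel p 1, ENNReal.rpow_add_of_nonneg _ _ (by linarith) zero_le_one, ENNReal.rpow_one]

/-- `(a^p · b)^{1/p} = a · b^{1/p}` in `ℝ≥0∞` for `0 < p`. [folklore] -/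
theorem rpow_mul_rpow_inv {a b : ℝ≥0∞} {p : ℝ} (hp : 0 < p) : (a ^ p * b) ^ (1 / p) = a * b ^ (1 / p) := by
  rw [ENNReal.mul_rpow_of_nonneg _ _ (by positivity), ← ENNReal.rpow_mul, mul_one_div_cancel hp.ne', ENNReal.rpow_one]

/-! ### Minkowski in time + Young in space for a Duhamel-type majorant -/

/-- **`L³` NORM OF A DUHAMEL-TYPE MAJORANT**: for a measurable kernel `κ : ℝ × ℝ³ → ℝ`, `κ ≥ 0`, with slice mass
`∫⁻ κ(σ,z)dz ≤ m_κ(σ)` (`σ > 0`), and a field `Φ ≥ 0` a.e.-measurable on `(0,t) × ℝ³`,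
`(∫⁻_x (∫⁻_{(0,t)×ℝ³} κ(t−τ,x−y)Φ(τ,y))³)^{1/3} ≤ ∫⁻_{τ∈(0,t)} m_κ(t−τ)·‖Φ(τ)‖_{L³} dτ`
(Tonelli, Minkowski's integral inequality in `τ`, Young in `y`). [folklore] -/
theorem rpow_lintegral_duhamelMajorant_le {κ : ℝ × EuclideanSpace ℝ (Fin 3) → ℝ} {mκ : ℝ → ℝ}
    {Φ : ℝ → EuclideanSpace ℝ (Fin 3) → ℝ} {t : ℝ} (hκm : Measurable κ) (hκ0 : ∀ q, 0 ≤ κ q)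
    (hκ1 : ∀ σ, 0 < σ → ∫⁻ z, ENNReal.ofReal (κ (σ, z)) ≤ ENNReal.ofReal (mκ σ))
    (hΦ : AEStronglyMeasurable (uncurry Φ) (volume.restrict (Ioo 0 t ×ˢ univ))) (hΦ0 : ∀ τ y, 0 ≤ Φ τ y) :
    (∫⁻ x, (∫⁻ p, ENNReal.ofReal (κ (t - p.1, x - p.2) * Φ p.1 p.2)
        ∂((volume.restrict (Ioo 0 t)).prod (volume : Measure (EuclideanSpace ℝ (Fin 3))))) ^ (3 : ℝ)) ^ (1 / (3 : ℝ)) ≤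
      ∫⁻ τ in Ioo 0 t, ENNReal.ofReal (mκ (t - τ)) * eLpNorm (Φ τ) 3 volume := by
  set ν : Measure ℝ := volume.restrict (Ioo 0 t) with hν
  set μ : Measure (ℝ × EuclideanSpace ℝ (Fin 3)) := ν.prod volume with hμ
  have hΦ' : AEStronglyMeasurable (uncurry Φ) μ := by
    rw [hμ, hν, Measure.restrict_prod_eq_prod_univ, ← Measure.volume_eq_prod]; exact hΦ
  -- the kernel and the field as `ℝ≥0∞` functions
  set K : EuclideanSpace ℝ (Fin 3) → ℝ × EuclideanSpace ℝ (Fin 3) → ℝ≥0∞ := fun x p =>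
    ENNReal.ofReal (κ (t - p.1, x - p.2)) with hK
  set F : ℝ × EuclideanSpace ℝ (Fin 3) → ℝ≥0∞ := fun p => ENNReal.ofReal (Φ p.1 p.2) with hF
  have hsplit : ∀ x p, ENNReal.ofReal (κ (t - p.1, x - p.2) * Φ p.1 p.2) = K x p * F p := fun x p => by
    rw [hK, hF]; exact ENNReal.ofReal_mul (hκ0 _)
  simp_rw [hsplit]
  -- measurability
  have hKq : Measurable fun q : EuclideanSpace ℝ (Fin 3) × (ℝ × EuclideanSpace ℝ (Fin 3)) => K q.1 q.2 :=
    (hκm.comp ((measurable_const.sub (measurable_fst.comp measurable_snd)).prodMk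
      (measurable_fst.sub (measurable_snd.comp measurable_snd)))).ennreal_ofReal
  have hKx : ∀ x, Measurable (K x) := fun x => hKq.comp (measurable_const.prodMk measurable_id)
  have hFm : AEMeasurable F μ := hΦ'.aemeasurable.ennreal_ofReal
  have hKF : ∀ x, AEMeasurable (fun p => K x p * F p) μ := fun x => (hKx x).aemeasurable.mul hFm
  -- Tonelli for each `x`
  have hiter : ∀ x, ∫⁻ p, K x p * F p ∂μ = ∫⁻ τ, ∫⁻ y, K x (τ, y) * F (τ, y) ∂volume ∂ν := fun x => by
    rw [hμ, lintegral_prod _ (hKF x)]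
  simp_rw [hiter]
  -- Minkowski in `τ`
  set f : EuclideanSpace ℝ (Fin 3) → ℝ → ℝ≥0∞ := fun x τ => ∫⁻ y, K x (τ, y) * F (τ, y) with hf
  have hqmp : Measure.QuasiMeasurePreserving
      (Prod.map Prod.snd id : (EuclideanSpace ℝ (Fin 3) × ℝ) × EuclideanSpace ℝ (Fin 3) → ℝ × EuclideanSpace ℝ (Fin 3))
      (((volume : Measure (EuclideanSpace ℝ (Fin 3))).prod ν).prod volume) μ := by
    rw [hμ]
    exact MeasureTheory.QuasiMeasurePreserving.prodMap
      (Measure.quasiMeasurePreserving_snd (μ := (volume : Measure (EuclideanSpace ℝ (Fin 3)))) (ν := ν))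
      (Measure.QuasiMeasurePreserving.id _)
  have hH : AEMeasurable (fun q : (EuclideanSpace ℝ (Fin 3) × ℝ) × EuclideanSpace ℝ (Fin 3) =>
      K q.1.1 (q.1.2, q.2) * F (q.1.2, q.2)) (((volume : Measure (EuclideanSpace ℝ (Fin 3))).prod ν).prod volume) := by
    have h1 : Measurable fun q : (EuclideanSpace ℝ (Fin 3) × ℝ) × EuclideanSpace ℝ (Fin 3) => K q.1.1 (q.1.2, q.2) :=
      (hκm.comp ((measurable_const.sub (measurable_snd.comp measurable_fst)).prodMk
        ((measurable_fst.comp measurable_fst).sub measurable_snd))).ennreal_ofReal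
    have h2 : AEMeasurable (fun q : (EuclideanSpace ℝ (Fin 3) × ℝ) × EuclideanSpace ℝ (Fin 3) => F (q.1.2, q.2))
        (((volume : Measure (EuclideanSpace ℝ (Fin 3))).prod ν).prod volume) :=
      hFm.comp_quasiMeasurePreserving hqmp
    exact h1.aemeasurable.mul h2
  have hfm : AEMeasurable (uncurry f) ((volume : Measure (EuclideanSpace ℝ (Fin 3))).prod ν) := hH.lintegral_prod_right'
  have hmink := rpow_inv_lintegral_rpow_lintegral_le' (μ := (volume : Measure (EuclideanSpace ℝ (Fin 3)))) (ν := ν)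
    (p := (3 : ℝ)) (by norm_num) hfm
  refine hmink.trans (lintegral_mono_ae ?_)
  -- Young in `y`, for a.e. `τ`
  have hslices : ∀ᵐ τ ∂ν, AEStronglyMeasurable (fun y => uncurry Φ (τ, y)) volume := by
    rw [hμ] at hΦ'; exact hΦ'.prodMk_left
  have hmem : ∀ᵐ τ ∂ν, τ ∈ Ioo 0 t := by rw [hν]; exact ae_restrict_mem measurableSet_Ioo
  filter_upwards [hslices, hmem] with τ hτm hτ
  have hσ : 0 < t - τ := sub_pos.2 hτ.2
  have hφm : AEMeasurable (fun y => F (τ, y)) volume := hτm.aemeasurable.ennreal_ofReal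
  have hKz : Measurable fun z : EuclideanSpace ℝ (Fin 3) => ENNReal.ofReal (κ (t - τ, z)) :=
    (hκm.comp (measurable_const.prodMk measurable_id)).ennreal_ofReal
  have hyoung := lintegral_rpow_lintegral_kernel_le (f := fun y => F (τ, y)) hKz hφm (p := (3 : ℝ)) (by norm_num)
  have hnorm : eLpNorm (Φ τ) 3 volume = (∫⁻ y, F (τ, y) ^ (3 : ℝ)) ^ (1 / (3 : ℝ)) := by
    rw [eLpNorm_eq_lintegral_rpow_enorm_toReal (by norm_num) (by norm_num)]
    simp only [ENNReal.toReal_ofNat]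
    congr 1
    refine lintegral_congr fun y => ?_
    rw [hF, Real.enorm_eq_ofReal (hΦ0 τ y)]
  calc (∫⁻ x, f x τ ^ (3 : ℝ)) ^ (1 / (3 : ℝ))
      = (∫⁻ x, (∫⁻ y, ENNReal.ofReal (κ (t - τ, x - y)) * F (τ, y)) ^ (3 : ℝ)) ^ (1 / (3 : ℝ)) := by rfl
    _ ≤ ((∫⁻ z, ENNReal.ofReal (κ (t - τ, z))) ^ (3 : ℝ) * ∫⁻ y, F (τ, y) ^ (3 : ℝ)) ^ (1 / (3 : ℝ)) :=
        ENNReal.rpow_le_rpow hyoung (by norm_num)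
    _ = (∫⁻ z, ENNReal.ofReal (κ (t - τ, z))) * (∫⁻ y, F (τ, y) ^ (3 : ℝ)) ^ (1 / (3 : ℝ)) := rpow_mul_rpow_inv (by norm_num)
    _ ≤ ENNReal.ofReal (mκ (t - τ)) * eLpNorm (Φ τ) 3 volume := by
        rw [hnorm]; exact mul_le_mul' (hκ1 _ hσ) le_rfl

end Summit.NavierStokesRegularity.NavierStokesRegularity.Cruxes.TypeIQuantSubcubicExp.QuietCollar

end
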